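import Literature.NumberTheory.LFunctions.HeilbronnBound
import Literature.NumberTheory.GaloisRepresentations.FramedRepDualProofs
import Mathlib.Analysis.Calculus.Deriv.Star
import HarnessLib

/-!
# Heilbronn's formalism, IV: the reflection `s ↦ s̄` — `L(s, ψ^∨) = conj L(s̄, ψ)` in rank one, and `n(G, Ind θ⁻¹) = n(G, Ind θ)` at real points

Topic `Literature/NumberTheory/LFunctions`, grouping namespace
`Literature.NumberTheory.LFunctions.Heilbronn` (sequel to `HeilbronnBound.lean`).
Everything in this file is PROVED (theorems only).

Stark's argument ([Stark1974, §3]) uses that at a REAL point `s₀` the order of vanishing of an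
abelian `L`-function is the same for a character and its complex conjugate. We prove:

* `meromorphicAt_conj_conj`, `meromorphicOrderAt_conj_conj` — the reflected function
  `z ↦ conj (g (conj z))` is meromorphic with `ord_x = ord_{x̄} g`;
* `FramedRep.dual_dual`, `coe_det_dual`, `eval_eulerFactorAt_dual_rankOne`,
  `artinLFunction_dual_rankOne` — for a character `ψ : Γ_M → GL_1(ℂ)` of degree one,
  `L_v(ψ^∨, t) = conj L_v(ψ, t̄)` (the Euler factor is `1 − det ψ(φ_𝔓) t` at unramified `v`,
  `1` otherwise — Neukirch VII, proof of (10.6), PROVED in the tree) and hence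
  **`L(s, ψ^∨) = conj L(s̄, ψ)`** on `re s > 1`;
* `artinOrder_indClassFun_inv` — for `conj s₀ = s₀`: **`n(G, Ind_H^G θ⁻¹) = n(G, Ind_H^G θ)`**
  (the cut-out character of `θ⁻¹` is the contragredient `ψ^∨`, `IsArtinQuotient.cutCharacter_inv`).

## References

* H. M. Stark, *Some effective cases of the Brauer–Siegel theorem*, Invent. Math. 23 (1974)
  135–152, §3. [Stark1974]
* J. Neukirch, *Algebraic Number Theory*, Springer 1999, VII proof of (10.6). [NeukirchANT1999]
-/

noncomputable section

open Filter Complex Set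
open scoped Topology

namespace Literature.NumberTheory.LFunctions

namespace Heilbronn

open Literature.NumberTheory.GaloisRepresentations Literature.NumberTheory.Automorphic

universe u


section Reflect

open scoped ComplexConjugate _root_.NumberField
open IsDedekindDomain

/-! ### Conjugate-reflected meromorphic functions -/

/-- Punctured neighbourhoods transfer under complex conjugation. [folklore] -/
theorem eventually_nhdsNE_conj {x : ℂ} {p : ℂ → Prop} (h : ∀ᶠ z in 𝓝[≠] (conj x), p z) :
    ∀ᶠ z in 𝓝[≠] x, p (conj z) := by
  rw [eventually_nhdsWithin_iff, Metric.eventually_nhds_iff] at h ⊢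
  obtain ⟨ε, hε, hball⟩ := h
  refine ⟨ε, hε, fun z hz hzx => hball ?_ ?_⟩
  · rwa [Complex.dist_conj_conj]
  · exact fun heq => hzx ((starRingEnd ℂ).injective heq)

/-- Neighbourhoods transfer under complex conjugation. [folklore] -/
theorem eventually_nhds_conj {x : ℂ} {p : ℂ → Prop} (h : ∀ᶠ z in 𝓝 (conj x), p z) :
    ∀ᶠ z in 𝓝 x, p (conj z) := by
  rw [Metric.eventually_nhds_iff] at h ⊢
  obtain ⟨ε, hε, hball⟩ := h
  exact ⟨ε, hε, fun z hz => hball (by rwa [Complex.dist_conj_conj])⟩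

/-- `z ↦ conj (h (conj z))` is analytic at `x` if `h` is analytic at `conj x`. [folklore] -/
theorem analyticAt_conj_conj {h : ℂ → ℂ} {x : ℂ} (hh : AnalyticAt ℂ h (conj x)) :
    AnalyticAt ℂ (fun z => conj (h (conj z))) x := by
  rw [Complex.analyticAt_iff_eventually_differentiableAt] at hh ⊢
  filter_upwards [eventually_nhds_conj hh] with z hz
  have := (differentiableAt_conj_conj_iff (f := h) (x := z)).mpr hz
  exact this

/-- `z ↦ conj (g (conj z))` is meromorphic at `x` if `g` is meromorphic at `conj x`. [folklore] -/
theorem meromorphicAt_conj_conj {g : ℂ → ℂ} {x : ℂ} (hg : MeromorphicAt g (conj x)) :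
    MeromorphicAt (fun z => conj (g (conj z))) x := by
  obtain ⟨n, hn⟩ := hg
  refine ⟨n, ?_⟩
  have h := analyticAt_conj_conj (x := x) hn
  refine h.congr (Filter.Eventually.of_forall fun z => ?_)
  simp only [smul_eq_mul, map_mul, map_pow, map_sub, Complex.conj_conj]

/-- **Orders are preserved under the reflection `g ↦ conj ∘ g ∘ conj`**:
`ord_x (z ↦ conj (g (conj z))) = ord_{conj x} g`. [folklore] -/
theorem meromorphicOrderAt_conj_conj {g : ℂ → ℂ} {x : ℂ} (hg : MeromorphicAt g (conj x)) :
    meromorphicOrderAt (fun z => conj (g (conj z))) x = meromorphicOrderAt g (conj x) := by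
  cases h : meromorphicOrderAt g (conj x) with
  | top =>
    rw [meromorphicOrderAt_eq_top_iff] at h ⊢
    filter_upwards [eventually_nhdsNE_conj h] with z hz
    rw [hz, map_zero]
  | coe n =>
    obtain ⟨G, hG, hG0, hfG⟩ := (meromorphicOrderAt_eq_int_iff hg).mp h
    rw [meromorphicOrderAt_eq_int_iff (meromorphicAt_conj_conj hg)]
    refine ⟨fun z => conj (G (conj z)), analyticAt_conj_conj hG, ?_, ?_⟩
    · simpa using hG0
    · filter_upwards [eventually_nhdsNE_conj hfG] with z hz
      rw [hz]
      simp only [smul_eq_mul, map_mul, map_zpow₀, map_sub, Complex.conj_conj]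

/-! ### Rank one: `L(s, ψ^∨) = conj L(s̄, ψ)` -/

variable {M : Type u} [Field M] [NumberField M]

/-- The contragredient of the contragredient is the representation itself. [folklore] -/
theorem FramedRep.dual_dual {Γ : Type*} [Group Γ] [TopologicalSpace Γ] {A : Type*} [CommRing A]
    [TopologicalSpace A] {n : ℕ} (ρ : FramedRep Γ A n) : FramedRep.dual (FramedRep.dual ρ) = ρ := by
  refine ContinuousMonoidHom.ext fun γ => Units.ext ?_
  rw [FramedRep.coe_dual_apply, ← map_inv (FramedRep.dual ρ) γ, FramedRep.coe_dual_apply, map_inv,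
    inv_inv, Matrix.transpose_transpose]

/-- Determinants of a framed Artin representation have norm `1` (finite image). [folklore] -/
theorem norm_coe_det_eq_one {n : ℕ} (ψ : FramedArtinRep M n) (σ : Field.absoluteGaloisGroup M) :
    ‖((FramedRep.det ψ σ : ℂˣ) : ℂ)‖ = 1 := by
  obtain ⟨m, hm, hpow⟩ := FramedRep.exists_coe_pow_eq_one ψ ψ.finite_range σ
  have hdet : ((FramedRep.det ψ σ : ℂˣ) : ℂ) ^ m = 1 := by
    rw [FramedRep.det_apply, Matrix.GeneralLinearGroup.val_det_apply, ← Matrix.det_pow, hpow,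
      Matrix.det_one]
  exact Complex.norm_eq_one_of_pow_eq_one hdet hm.ne'

/-- `det ψ^∨(σ) = conj (det ψ(σ))` for a framed Artin representation. [folklore] -/
theorem coe_det_dual (n : ℕ) (ψ : FramedArtinRep M n) (σ : Field.absoluteGaloisGroup M) :
    ((FramedRep.det (FramedRep.dual ψ) σ : ℂˣ) : ℂ) = conj ((FramedRep.det ψ σ : ℂˣ) : ℂ) := by
  rw [← Complex.inv_eq_conj (norm_coe_det_eq_one ψ σ), FramedRep.det_apply, FramedRep.det_apply,
    show (FramedRep.dual ψ) σ = glTransposeInv (Fin n) ℂ (ψ σ) from rfl, det_glTransposeInv,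
    Units.val_inv_eq_inv_val]

omit [NumberField M] in
/-- Unramifiedness transfers to the contragredient (Artin representations on `ℂⁿ`). [folklore] -/
theorem isUnramifiedAt_toArtinRep_dual {n : ℕ} {ψ : FramedArtinRep M n} {v : HeightOneSpectrum (𝓞 M)}
    (h : GaloisRep.IsUnramifiedAt v ψ.toArtinRep) :
    GaloisRep.IsUnramifiedAt v (FramedArtinRep.toArtinRep (FramedRep.dual ψ)) :=
  (FramedGaloisRep.isUnramifiedAt_toGaloisRep_iff v (FramedRep.dual ψ)).mpr
    (FramedGaloisRep.isUnramifiedAt_dual ((FramedGaloisRep.isUnramifiedAt_toGaloisRep_iff v ψ).mp h))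

/-- **Euler factors of the contragredient in rank one**: `L_v(ψ^∨, t) = conj (L_v(ψ, conj t))`.
[cite: NeukirchANT1999, Ch. VII §10 Thm. (10.6) (proof)] -/
theorem eval_eulerFactorAt_dual_rankOne (ψ : FramedArtinRep M 1) (v : HeightOneSpectrum (𝓞 M))
    (t : ℂ) :
    ((FramedArtinRep.toArtinRep (FramedRep.dual ψ)).eulerFactorAt v).eval t =
      conj ((ψ.toArtinRep.eulerFactorAt v).eval (conj t)) := by
  by_cases hur : GaloisRep.IsUnramifiedAt v ψ.toArtinRep
  · obtain ⟨𝔓, h𝔓⟩ := v.primesAbove_nonempty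
    obtain ⟨σ, hσ⟩ := IsDedekindDomain.HeightOneSpectrum.exists_isArithFrobAt_of_mem_primesAbove_holds h𝔓
    rw [FramedArtinRep.eval_eulerFactorAt_of_isUnramifiedAt _ (isUnramifiedAt_toArtinRep_dual hur) h𝔓 hσ,
      FramedArtinRep.eval_eulerFactorAt_of_isUnramifiedAt _ hur h𝔓 hσ, map_sub, map_one, map_mul,
      Complex.conj_conj, coe_det_dual]
  · have hur' : ¬ GaloisRep.IsUnramifiedAt v (FramedArtinRep.toArtinRep (FramedRep.dual ψ)) := by
      intro h
      have := isUnramifiedAt_toArtinRep_dual h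
      rw [FramedRep.dual_dual] at this
      exact hur this
    rw [FramedArtinRep.eulerFactorAt_eq_one_of_not_isUnramifiedAt _ hur,
      FramedArtinRep.eulerFactorAt_eq_one_of_not_isUnramifiedAt _ hur', Polynomial.eval_one,
      Polynomial.eval_one, map_one]

/-- `conj ((N : ℂ)^(-s)) = (N : ℂ)^(-conj s)` for a natural number `N`. [folklore] -/
theorem conj_natCast_cpow_neg (N : ℕ) (s : ℂ) :
    conj ((N : ℂ) ^ (-s)) = (N : ℂ) ^ (-conj s) := by
  have harg : (N : ℂ).arg ≠ Real.pi := by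
    rw [Complex.natCast_arg]; exact Real.pi_ne_zero.symm
  have h := Complex.cpow_conj (N : ℂ) (-s) harg
  rw [Complex.conj_natCast, map_neg] at h
  exact h.symm

/-- **`L(s, ψ^∨) = conj L(conj s, ψ)` for a character `ψ` of degree one**, on `re s > 1`
(Euler factor by Euler factor). [cite: NeukirchANT1999, Ch. VII §10 Thm. (10.6) (proof)] -/
theorem artinLFunction_dual_rankOne (ψ : FramedArtinRep M 1) {s : ℂ} (hs : 1 < s.re) :
    artinLFunction (FramedArtinRep.toArtinRep (FramedRep.dual ψ)) s =
      conj (artinLFunction ψ.toArtinRep (conj s)) := by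
  have hs' : 1 < (conj s).re := by simpa using hs
  set f : HeightOneSpectrum (𝓞 M) → ℂ :=
    fun v => ((ψ.toArtinRep.eulerFactorAt v).eval ((v.residueCard : ℂ) ^ (-conj s)))⁻¹ with hf
  have hmul : Multipliable f := multipliable_artinLFunction_holds ψ.toArtinRep hs'
  have hterm : (fun v : HeightOneSpectrum (𝓞 M) =>
      (((FramedArtinRep.toArtinRep (FramedRep.dual ψ)).eulerFactorAt v).eval
        ((v.residueCard : ℂ) ^ (-s)))⁻¹) = starRingEnd ℂ ∘ f := by
    funext v
    rw [Function.comp_apply, hf, map_inv₀, eval_eulerFactorAt_dual_rankOne, conj_natCast_cpow_neg]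
  unfold artinLFunction
  rw [hterm]
  exact (hmul.hasProd.map (starRingEnd ℂ) Complex.continuous_conj).tprod_eq

end Reflect

/-! ### Realness of Heilbronn's character at a real point -/

section Real

open scoped ComplexConjugate
open Literature.RepresentationTheory.FiniteGroups

variable {F : Type} [Field F] [NumberField F] {G : Type} [Group G] [Fintype G]
  {q : Field.absoluteGaloisGroup F →* G}

/-- **`n(G, Ind_H^G θ⁻¹) = n(G, Ind_H^G θ)` at a REAL point `s₀`**: the cut-out character of
`θ⁻¹` is the contragredient of that of `θ` (`IsArtinQuotient.cutCharacter_inv`), whose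
`L`-function is `conj L(conj s, ψ)`; reflect a meromorphic continuation. [cite: Stark1974, §3] -/
theorem artinOrder_indClassFun_inv (hq : IsArtinQuotient q) {s₀ : ℂ} (hreal : conj s₀ = s₀)
    (H : Subgroup G) (θ : H →* ℂˣ) :
    artinOrder s₀ (indClassFun H (fun h => (θ⁻¹ h : ℂ)) ∘ q) =
      artinOrder s₀ (indClassFun H (fun h => (θ h : ℂ)) ∘ q) := by
  haveI := numberField_quotientFixedField hq H
  obtain ⟨g, hg, hgL⟩ := artinLFunction_hasMeromorphicContinuation (hq.cutCharacter H θ).toArtinRep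
  set g' : ℂ → ℂ := fun z => conj (g (conj z)) with hg'
  have hg'm : Meromorphic g' := fun x => meromorphicAt_conj_conj (hg (conj x))
  have hg'L : ∀ s : ℂ, 1 < s.re → g' s = artinLFunction (hq.cutCharacter H θ⁻¹).toArtinRep s := by
    intro s hs
    rw [hq.cutCharacter_inv, artinLFunction_dual_rankOne _ hs, ← hgL (conj s) (by simpa using hs)]
  have h1 := artinOrder_indClassFun_eq hq s₀ H θ⁻¹ hg'm hg'L
  have h2 := artinOrder_indClassFun_eq hq s₀ H θ hg hgL
  rw [meromorphicOrderAt_conj_conj (hg (conj s₀)), hreal, ← h2] at h1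
  exact_mod_cast h1

end Real


end Heilbronn

end Literature.NumberTheory.LFunctions

end
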